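import Mathlib
import Summits.ResolutionOfSingularities.ResolutionOfSingularities.Theorems.WeightedInvariantLocalWeightedDropWildMonicKangarooShearBound
import Summits.ResolutionOfSingularities.ResolutionOfSingularities.Theorems.WeightedInvariantLocalWeightedDropWildMonicKangarooHeight
import Summits.ResolutionOfSingularities.ResolutionOfSingularities.Theorems.WeightedInvariantLocalWeightedDropWildMonicFlagDropTangentKMax
import Summits.ResolutionOfSingularities.ResolutionOfSingularities.Theorems.WeightedInvariantLocalWeightedDropWildMonicShiftCoeff

/-!
# `WeightedInvariant.LocalWeightedDrop`, line `hasse-ridge-face-selection`, S3ρ flag line (Uk-ρD3 `DropAxisKangaroo`):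
# the KANGAROO BOUND IN FLAG VOCABULARY — `dFlagN` of every flag tuple `shift d (A ∘ shift φ) g` drops below `d_𝓕`

Crux item stmt-ResolutionOfSingularities-8899 `LocalWeightedDrop` (route `ResolutionOfSingularities/WeightedInvariant`), engine of the
door `HypersurfaceCentreConstruction` stmt-ResolutionOfSingularities-19897.  [OURS · L1 W4.3, chain w43, seat res-type-056 ((C8) D-d KANGAROO →
Uk-ρD3 / hbounds (iii)).  MODEL: S. Perlega, arXiv:2011.14443 [cite: Perlega2020, Prop. 9.1.4 case (4) («`d_𝓖 ≤ d₁ + ε ≤ d_𝓕/n_𝓖 + ε` …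
`d_𝓖 < d_𝓕`»), Prop. 7.4.8 (2) («for `n ≥ N`, `d_𝓕 = −1`»: `d = 0` in Prop. 6.2.3 (3)/(4)), Prop. 5.1.3 (cleanness is kept along the flag's
own shear — Lemma 7.4.4)] = Hauser–Perlega 2024 Prop. 4 (iv).  Nothing here is a statement of H. Hironaka's manuscript
[claim: Hironaka2017, status: under-review]; OUR theorems in the vocabulary of res-L1-w43-stub-3 / stub-5 (`flagTuple`-shaped tuples
`shift d (A ∘ PurePowerFlag.shift φ) g`, `wOrdN`, `initHeight`, `mFlagN`, `dFlagN` at scale `L = d!`).]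

SETTING (letters `0 = x`, `1 = y` = flag letter; weight `w 0 = 1`, `w 1 = n`; `k` of characteristic `p`): a tuple `A` with `m = wMin w A < ⊤`,
`w`-CLEAN (`IsWClean p w A`); a shear `φ` with `[x^i]φ = 0` for `i < n` and `[xⁿ]φ = c ≠ 0` (a flag curve `y + φ(x) = 0` of tangency `n`);
`B = A ∘ PurePowerFlag.shift φ`; any hypersurface re-centring `g`; `N = newtonSet (shift d B g)`.
* `isWClean_pshift` — `B` is `w`-clean too (the initial forms along the shear are the Taylor shifts `P_j(Y + c)`; clause `(3)_w` is carried by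
  the Hasse derivative `∂_{p^e}` that sees a non-`q`-divisible exponent, `exists_hasseDeriv_prime_pow_ne_zero`, and the tree's Lucas digit
  `dvd_choose_pow_mul_of_not_dvd`); hence `wMin w (shift d B g) ≤ m` (stub-7's `wMin_shift_le_of_isWClean`) and `= m` when `d!·ord_w g ≥ m`.
* `initHeight_shift_le` — under `d!·ord_w g ≥ m`: `initHeight n N ≤ dInit w (newtonSet A) + d!/p`, `dInit < d! ⇒ initHeight < d!`, and
  `d!·ord_w g > m ⇒ initHeight ≤ dInit` (the three clauses of Prop. 6.2.3 on stub-5's `d_{𝓕,x}`), with `wOrdN n N = m`.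
* `dFlagN_shift_lt` — THE DROP: if `n ≥ 2`, `1 ≤ dF`, `n · dInit w (newtonSet A) ≤ dF` (Prop. 6.2.4, `…KangarooBlowupInit`) and the flag is
  at least as good as `g = 0` on `m` (`mFlagN d! n (newtonSet B) ≤ mFlagN d! n N`, a consequence of validity), then `dFlagN d! n N < dF`.
* `dFlagN_shift_eq_zero_of_dInit_eq_zero` — hbounds (iii) / Prop. 7.4.8 (2): `dInit w (newtonSet A) = 0 ⇒ dFlagN d! n N = 0` (same validity
  hypothesis), the large-tangency vanishing once stub-5's `…FlagNnLarge` supplies `dInit = 0`.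
AI-written; gate-accepted means sorry-free with standard axioms, not refereed.
-/

set_option linter.dupNamespace false -- mandated namespace of this single-conjunct summit

noncomputable section

namespace Summit.ResolutionOfSingularities.ResolutionOfSingularities.Theorems

namespace WildMonic

open MvPowerSeries MonicDescent

variable {k : Type} [Field k] {w : Fin 2 → ℕ} {n : ℕ} (hw0 : w 0 = 1) (hw1 : w 1 = n) (hn : 1 ≤ n)
  {φ : PowerSeries k} {c : k} (hφ : ∀ m, m < n → PowerSeries.coeff m φ = 0) (hc : PowerSeries.coeff n φ = c) (hc0 : c ≠ 0)
  {d : ℕ} (A : Fin d → MvPowerSeries (Fin 2) k) (p : ℕ) [Fact p.Prime] [CharP k p]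

/-! ## Cleanness is kept along the shear -/

/-- If every exponent of `T ∈ k[Y]` is divisible by `q = p^a` then `∂_{p^e} T = 0` for `e < a` (Lucas: the `e`-th digit of a multiple of `p^a` is
`0`). -/
theorem hasseDeriv_eq_zero_of_forall_dvd {a e : ℕ} (hea : e < a) {T : Polynomial k} (hT : ∀ j ∈ T.support, p ^ a ∣ j) :
    Polynomial.hasseDeriv (p ^ e) T = 0 := by
  have hp : p.Prime := Fact.out
  ext m
  rw [Polynomial.hasseDeriv_coeff, Polynomial.coeff_zero]
  by_cases hm : T.coeff (m + p ^ e) = 0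
  · rw [hm, mul_zero]
  · obtain ⟨u, hu⟩ := hT _ (Polynomial.mem_support_iff.mpr hm)
    have hdvd : p ∣ (m + p ^ e).choose (p ^ e) := by
      rw [hu]
      exact Literature.RingTheory.MvPowerSeries.dvd_choose_pow_mul_of_not_dvd hp (by
        rw [Nat.pow_dvd_pow_iff_le_right hp.one_lt]; omega)
    rw [(CharP.cast_eq_zero_iff k p _).mpr hdvd, zero_mul]

include hw0 hw1 hn hφ hc in
/-- `w`-CLEANNESS IS KEPT ALONG THE SHEAR (Perlega Prop. 5.1.3 / Lemma 7.4.4 in our setting: the slot orders are unchanged and the initial form of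
the slot `d − q` along the shear is the Taylor shift `P(Y + c)`, which has an exponent outside `qℕ` as soon as `P` has one). -/
theorem isWClean_pshift (hclean : IsWClean p w A) :
    IsWClean p w (fun j => subst (PurePowerFlag.shift φ) (A j)) := by
  have hxy : (0 : Fin 2) ≠ 1 := fin2_zero_ne_one
  have hslot : ∀ j, slotWOrd w (fun j => subst (PurePowerFlag.shift φ) (A j)) j = slotWOrd w A j := slotWOrd_pshift hw0 hw1 hn hφ hc A
  have hmB : wMin w (fun j => subst (PurePowerFlag.shift φ) (A j)) = wMin w A := wMin_pshift hw0 hw1 hn hφ hc A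
  rcases hclean with ⟨i, hi, hatt⟩ | h2 | ⟨i, e, hi, he, hnd⟩
  · exact Or.inl ⟨i, hi, by rw [hslot, hmB, hatt]⟩
  · exact Or.inr (Or.inl fun i hi => by rw [hslot, hmB]; exact h2 i hi)
  · right; right
    -- the slot `i = d − q` of `A`: non-zero, weight `W`, flattening `P` with the exponent `e 1`
    have hAi : A i ≠ 0 := by intro h; rw [h] at he; simp [initSupp] at he
    set W := ((A i).weightedOrder w).toNat with hWdef
    have hhom : IsWeightedHomogeneous w (inW w (A i)) W := isWeightedHomogeneous_inW w (A i)
    have hce := (coeff_inW_ne_zero_iff w (A i) e).mpr he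
    obtain ⟨hwe, heq⟩ := eq_single_add_single_of_coeff_ne_zero hxy hw0 hw1 hhom hce
    set P := flatPoly 0 1 n W (inW w (A i)) with hPdef
    have hBi : subst (PurePowerFlag.shift φ) (A i) ≠ 0 := subst_pshift_ne_zero hw0 hw1 hn hφ hc hAi
    have hWB : ((subst (PurePowerFlag.shift φ) (A i)).weightedOrder w).toNat = W := by
      rw [weightedOrder_subst_pshift hw0 hw1 hn hφ hc hAi]
    have hhomB : IsWeightedHomogeneous w (inW w (subst (PurePowerFlag.shift φ) (A i))) W := by
      rw [← hWB]; exact isWeightedHomogeneous_inW w _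
    have hflat : flatPoly 0 1 n W (inW w (subst (PurePowerFlag.shift φ) (A i))) = Polynomial.taylor c P :=
      flatPoly_inW_subst_pshift hw0 hw1 hn hφ hc hAi rfl
    -- a witness exponent on the sheared side
    suffices hex : ∃ j ∈ (Polynomial.taylor c P).support, ¬ (qOf p d ∣ (W - n * j) ∧ qOf p d ∣ j) by
      obtain ⟨j, hj, hnd'⟩ := hex
      rw [← hflat, mem_support_flatPoly_iff (x := 0) (y := 1) (W := W) (G := inW w (subst (PurePowerFlag.shift φ) (A i))) hn] at hj
      refine ⟨i, Finsupp.single 0 (W - n * j) + Finsupp.single 1 j, hi, (coeff_inW_ne_zero_iff w _ _).mp hj.2, ?_⟩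
      rwa [single_add_single_apply_x hxy, single_add_single_apply_y hxy]
    have hT0 : Polynomial.taylor c P ≠ 0 := by
      rw [← hflat]; exact fun h => inW_ne_zero w hBi ((flatPoly_eq_zero_iff hxy hw0 hw1 hn hhomB).mp h)
    by_cases hqW : qOf p d ∣ W
    · -- `q ∣ W`: then `q ∤ e 1`, and the Hasse derivative transports a non-`q`-divisible exponent to the Taylor shift
      have hq1 : ¬ qOf p d ∣ e 1 := by
        intro h1; apply hnd
        have h0 : qOf p d ∣ e 0 := by
          rw [show e 0 = W - n * e 1 by omega]; exact Nat.dvd_sub hqW (Dvd.dvd.mul_left h1 n)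
        exact ⟨h0, h1⟩
      have hmem : e 1 ∈ P.support :=
        (mem_support_flatPoly_iff (x := 0) (y := 1) (W := W) (G := inW w (A i)) hn (e 1)).mpr ⟨by omega, by rw [← heq]; exact hce⟩
      obtain ⟨e', hea, -, hQ⟩ := exists_hasseDeriv_prime_pow_ne_zero (k := k) p (a := d.factorization p) ⟨e 1, hmem, hq1⟩
      by_contra hall
      push Not at hall
      have hT : ∀ j ∈ (Polynomial.taylor c P).support, p ^ d.factorization p ∣ j := fun j hj => (hall j hj).2
      have h0 := hasseDeriv_eq_zero_of_forall_dvd (k := k) p hea hT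
      rw [hasseDeriv_taylor_comm, Polynomial.taylor_eq_zero] at h0
      exact hQ h0
    · -- `q ∤ W`: any exponent works
      obtain ⟨j, hj⟩ : ∃ j, j ∈ (Polynomial.taylor c P).support := ⟨_, Polynomial.natDegree_mem_support_of_nonzero hT0⟩
      refine ⟨j, hj, fun ⟨h0, h1⟩ => hqW ?_⟩
      have hjW : n * j ≤ W := by
        have := Polynomial.le_natDegree_of_mem_supp _ hj
        rw [Polynomial.natDegree_taylor] at this
        exact (le_div_iff_mul_le' hn).mp (this.trans (natDegree_flatPoly_le 0 1 n W _))
      have : W = (W - n * j) + n * j := by omega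
      rw [this]; exact Nat.dvd_add h0 (Dvd.dvd.mul_left h1 n)

include hw0 hw1 hn hφ hc in
/-- … hence no re-centring raises `m` along the shear: `wMin w (shift d B g) ≤ m` (stub-7's Prop. 5.1.3), and `= m` when `d!·ord_w g ≥ m`. -/
theorem wMin_shift_pshift_eq (hclean : IsWClean p w A) {m : ℕ} (hm : wMin w A = m) (g : MvPowerSeries (Fin 2) k)
    (hG : wMin w A ≤ (d.factorial : ℕ∞) * g.weightedOrder w) :
    wMin w (shift d (fun j => subst (PurePowerFlag.shift φ) (A j)) g) = m := by
  have hm' : wMin w A ≠ ⊤ := by rw [hm]; exact ENat.coe_ne_top m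
  have hmB : wMin w (fun j => subst (PurePowerFlag.shift φ) (A j)) = wMin w A := wMin_pshift hw0 hw1 hn hφ hc A
  apply le_antisymm
  · rw [← hm, ← hmB]
    exact wMin_shift_le_of_isWClean w _ g p (isWClean_pshift hw0 hw1 hn hφ hc A p hclean) (by rw [hmB]; exact hm')
  · rw [← hm, ← hmB]
    exact wMin_le_wMin_shift w _ g (by rw [hmB]; exact hG)

/-! ## The bound on `d_{𝓕,x}` and the drop of `d_𝓕` -/

include hw0 hw1 hn hφ hc hc0 in
/-- PROP. 6.2.3 ON STUB-5's `d_{𝓕,x}`: for `N = newtonSet (shift d (A ∘ shift φ) g)` with `d!·ord_w g ≥ m`: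
`wOrdN n N = m`, `initHeight n N ≤ dInit + d!/p`, `dInit < d! ⇒ initHeight < d!`, and `d!·ord_w g > m ⇒ initHeight ≤ dInit`. -/
theorem initHeight_shift_le (hclean : IsWClean p w A) {m : ℕ} (hm : wMin w A = m) (g : MvPowerSeries (Fin 2) k)
    (hG : wMin w A ≤ (d.factorial : ℕ∞) * g.weightedOrder w) :
    wOrdN n (newtonSet (shift d (fun j => subst (PurePowerFlag.shift φ) (A j)) g)) = m ∧
      initHeight n (newtonSet (shift d (fun j => subst (PurePowerFlag.shift φ) (A j)) g)) ≤ dInit w (newtonSet A) + d.factorial / p ∧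
      (dInit w (newtonSet A) < d.factorial →
        initHeight n (newtonSet (shift d (fun j => subst (PurePowerFlag.shift φ) (A j)) g)) < d.factorial) ∧
      (wMin w A < (d.factorial : ℕ∞) * g.weightedOrder w →
        initHeight n (newtonSet (shift d (fun j => subst (PurePowerFlag.shift φ) (A j)) g)) ≤ dInit w (newtonSet A)) := by
  have hmS := wMin_shift_pshift_eq hw0 hw1 hn hφ hc A p hclean hm g hG
  have hih := initHeight_newtonSet_eq_dStar hw0 hw1 (shift d (fun j => subst (PurePowerFlag.shift φ) (A j)) g) hmS
  obtain ⟨h2, h4⟩ := pshift_dStar_shift_le hw0 hw1 hn hφ hc hc0 A g p hm hclean hG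
  refine ⟨wOrdN_newtonSet_eq_of_wMin_eq hw0 hw1 _ hmS, ?_, fun hlt => ?_, fun hlt => ?_⟩
  · rw [← hih] at h2; exact_mod_cast h2
  · have h := h4 hlt; rw [← hih] at h; exact_mod_cast h
  · have h := pshift_dStar_shift_le_of_lt hw0 hw1 hn hφ hc hc0 A g hm hlt; rw [← hih] at h; exact_mod_cast h

include hw0 hw1 hn hφ hc hc0 in
/-- THE KANGAROO DROP IN FLAG VOCABULARY (Perlega Prop. 9.1.4 case (4)): `n ≥ 2`, `A` `w`-clean with finite `m`, `1 ≤ dF`, `n·dInit ≤ dF`, and the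
flag `(g, φ)` at least as good on `m` as `(0, φ)` (`mFlagN` of `B` ≤ `mFlagN` of `shift d B g` — implied by validity) ⇒ `dFlagN d! n N < dF`. -/
theorem dFlagN_shift_lt (hn2 : 2 ≤ n) (hclean : IsWClean p w A) {m : ℕ} (hm : wMin w A = m) (g : MvPowerSeries (Fin 2) k)
    (hval : mFlagN d.factorial n (newtonSet (fun j => subst (PurePowerFlag.shift φ) (A j))) ≤
      mFlagN d.factorial n (newtonSet (shift d (fun j => subst (PurePowerFlag.shift φ) (A j)) g)))
    {dF : ℕ} (hdF : 1 ≤ dF) (h624 : n * dInit w (newtonSet A) ≤ dF) :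
    dFlagN d.factorial n (newtonSet (shift d (fun j => subst (PurePowerFlag.shift φ) (A j)) g)) < dF := by
  have hp : p.Prime := Fact.out
  have hm' : wMin w A ≠ ⊤ := by rw [hm]; exact ENat.coe_ne_top m
  have hd : 0 < d := pos_of_wMin_ne_top w A hm'
  have hL1 : 1 ≤ d.factorial := Nat.one_le_iff_ne_zero.mpr (Nat.factorial_ne_zero d)
  have hmB : wMin w (fun j => subst (PurePowerFlag.shift φ) (A j)) = m := by rw [wMin_pshift hw0 hw1 hn hφ hc A, hm]
  have hfne : ((d.factorial : ℕ) : ℕ∞) ≠ 0 := by exact_mod_cast (Nat.factorial_pos d).ne'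
  by_cases hG : wMin w A ≤ (d.factorial : ℕ∞) * g.weightedOrder w
  · obtain ⟨hwOrd, h2, h4, h3⟩ := initHeight_shift_le hw0 hw1 hn hφ hc hc0 A p hclean hm g hG
    -- (3) in `mFlagN` form: `d! ∤ mFlagN ⇒ initHeight ≤ dInit`
    have h3' : ¬ d.factorial ∣ mFlagN d.factorial n (newtonSet (shift d (fun j => subst (PurePowerFlag.shift φ) (A j)) g)) →
        initHeight n (newtonSet (shift d (fun j => subst (PurePowerFlag.shift φ) (A j)) g)) ≤ dInit w (newtonSet A) := by
      intro hnd
      have hmF : mFlagN d.factorial n (newtonSet (shift d (fun j => subst (PurePowerFlag.shift φ) (A j)) g)) = m := by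
        rcases le_or_gt (n * d.factorial) (wOrdN n (newtonSet (shift d (fun j => subst (PurePowerFlag.shift φ) (A j)) g))) with h | h
        · rw [mFlagN_of_le h, ← hwOrd]
        · exact absurd (by rw [mFlagN_of_lt h]; exact Dvd.intro_left _ rfl) hnd
      rw [hmF] at hnd
      refine h3 (lt_of_le_of_ne hG fun heq => hnd ?_)
      have hgfin : g.weightedOrder w ≠ ⊤ := by
        intro h; rw [h, ENat.mul_top hfne, hm] at heq; exact ENat.coe_ne_top m heq
      refine ⟨(g.weightedOrder w).toNat, ?_⟩
      have : (m : ℕ∞) = ((d.factorial * (g.weightedOrder w).toNat : ℕ) : ℕ∞) := by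
        rw [← hm, heq, Nat.cast_mul, ENat.coe_toNat hgfin]
      exact_mod_cast this
    -- the convention and the arithmetic of Prop. 9.1.4 case (4)
    have h2d1 : 2 * dInit w (newtonSet A) ≤ dF := le_trans (Nat.mul_le_mul_right _ hn2) h624
    have hLp : d.factorial / p ≤ d.factorial / 2 := Nat.div_le_div_left hp.two_le (by norm_num)
    have hL2 : 2 * (d.factorial / 2) ≤ d.factorial := Nat.mul_div_le d.factorial 2
    rcases dFlagN_eq_or d.factorial n (newtonSet (shift d (fun j => subst (PurePowerFlag.shift φ) (A j)) g)) with hval' | hzero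
    · rw [hval']
      by_cases hdiv : d.factorial ∣ mFlagN d.factorial n (newtonSet (shift d (fun j => subst (PurePowerFlag.shift φ) (A j)) g))
      · by_cases hge : d.factorial ≤ initHeight n (newtonSet (shift d (fun j => subst (PurePowerFlag.shift φ) (A j)) g))
        · -- `d! ≤ ih ≤ d1 + d!/2`, `2 d1 ≤ dF` ⇒ `ih ≤ dF`; and `ih = dF` forces `d1 < d!`, hence (4): `ih < d!` — absurd
          by_contra hge'
          rw [not_lt] at hge'
          have h5 : dInit w (newtonSet A) < d.factorial := by omega
          have h6 := h4 h5
          omega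
        · have h0 := dFlagN_of_lt_of_dvd (not_le.mp hge) hdiv
          rw [hval'] at h0
          rw [h0]; exact hdF
      · have := h3' hdiv
        omega
    · rw [hzero]; exact hdF
  · -- `d!·ord_w g < m`: the flag is at least as good as `g = 0` only if `m` is below the floor `n·d!`, and then `d_𝓕 = 0`
    rw [not_le] at hG
    have hmS : wMin w (shift d (fun j => subst (PurePowerFlag.shift φ) (A j)) g) = (d.factorial : ℕ∞) * g.weightedOrder w :=
      wMin_shift_eq_of_gt w _ g hd (by rw [hmB, ← hm]; exact hG)
    have hgfin : g.weightedOrder w ≠ ⊤ := by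
      intro h; rw [h, ENat.mul_top hfne] at hG; exact not_top_lt hG
    have hmS' : wMin w (shift d (fun j => subst (PurePowerFlag.shift φ) (A j)) g) =
        ((d.factorial * (g.weightedOrder w).toNat : ℕ) : ℕ∞) := by rw [hmS, Nat.cast_mul, ENat.coe_toNat hgfin]
    have hNne : (newtonSet (shift d (fun j => subst (PurePowerFlag.shift φ) (A j)) g)).Nonempty := by
      obtain ⟨P, hP⟩ := initPts_newtonSet_nonempty w _ hmS'
      exact ⟨P, hP.1⟩
    have hwN : wOrdN n (newtonSet (shift d (fun j => subst (PurePowerFlag.shift φ) (A j)) g)) = d.factorial * (g.weightedOrder w).toNat :=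
      wOrdN_newtonSet_eq_of_wMin_eq hw0 hw1 _ hmS'
    have hwB : wOrdN n (newtonSet (fun j => subst (PurePowerFlag.shift φ) (A j))) = m := wOrdN_newtonSet_eq_of_wMin_eq hw0 hw1 _ hmB
    have hlt : d.factorial * (g.weightedOrder w).toNat < m := by
      have : ((d.factorial * (g.weightedOrder w).toNat : ℕ) : ℕ∞) < (m : ℕ∞) := by rw [← hmS', hmS, ← hm]; exact hG
      exact_mod_cast this
    have hfloor : wOrdN n (newtonSet (shift d (fun j => subst (PurePowerFlag.shift φ) (A j)) g)) < n * d.factorial := by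
      by_contra hge
      rw [not_lt] at hge
      have h1 : mFlagN d.factorial n (newtonSet (shift d (fun j => subst (PurePowerFlag.shift φ) (A j)) g)) =
          d.factorial * (g.weightedOrder w).toNat := by rw [mFlagN_of_le hge, hwN]
      have h2 : m ≤ mFlagN d.factorial n (newtonSet (fun j => subst (PurePowerFlag.shift φ) (A j))) := by
        rcases le_or_gt (n * d.factorial) (wOrdN n (newtonSet (fun j => subst (PurePowerFlag.shift φ) (A j)))) with h | h
        · rw [mFlagN_of_le h, hwB]
        · rw [hwB] at h; rw [hwN] at hge; omega
      rw [h1] at hval; omega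
    rw [dFlagN_eq_zero_of_wOrdN_lt hNne hfloor]
    exact hdF

include hw0 hw1 hn hφ hc hc0 in
/-- HBOUNDS (iii) / PERLEGA PROP. 7.4.8 (2): if the initial points of `A` have residual order `dInit = 0` (stub-5's large-tangency situation,
`…WildMonicFlagNnLarge`), then EVERY flag tuple `shift d (A ∘ shift φ) g` that is at least as good as `g = 0` on `m` has `dFlagN = 0`
(`d_* ≤ 0 + d!/p < d!`, and `d! ∣ m_𝓕` or `d_* ≤ 0`). -/
theorem dFlagN_shift_eq_zero_of_dInit_eq_zero (hclean : IsWClean p w A) {m : ℕ} (hm : wMin w A = m) (g : MvPowerSeries (Fin 2) k)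
    (hval : mFlagN d.factorial n (newtonSet (fun j => subst (PurePowerFlag.shift φ) (A j))) ≤
      mFlagN d.factorial n (newtonSet (shift d (fun j => subst (PurePowerFlag.shift φ) (A j)) g)))
    (h0 : dInit w (newtonSet A) = 0) :
    dFlagN d.factorial n (newtonSet (shift d (fun j => subst (PurePowerFlag.shift φ) (A j)) g)) = 0 := by
  have hm' : wMin w A ≠ ⊤ := by rw [hm]; exact ENat.coe_ne_top m
  have hd : 0 < d := pos_of_wMin_ne_top w A hm'
  have hL0 : 0 < d.factorial := Nat.factorial_pos d
  have hmB : wMin w (fun j => subst (PurePowerFlag.shift φ) (A j)) = m := by rw [wMin_pshift hw0 hw1 hn hφ hc A, hm]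
  have hfne : ((d.factorial : ℕ) : ℕ∞) ≠ 0 := by exact_mod_cast hL0.ne'
  by_cases hG : wMin w A ≤ (d.factorial : ℕ∞) * g.weightedOrder w
  · obtain ⟨hwOrd, -, h4, h3⟩ := initHeight_shift_le hw0 hw1 hn hφ hc hc0 A p hclean hm g hG
    have hih : initHeight n (newtonSet (shift d (fun j => subst (PurePowerFlag.shift φ) (A j)) g)) < d.factorial := h4 (by rw [h0]; exact hL0)
    by_cases hdiv : d.factorial ∣ mFlagN d.factorial n (newtonSet (shift d (fun j => subst (PurePowerFlag.shift φ) (A j)) g))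
    · exact dFlagN_of_lt_of_dvd hih hdiv
    · -- `d! ∤ m_𝓕` ⇒ `m_𝓕 = m`, `d!·ord_w g > m`, `ih ≤ dInit = 0`
      have hmF : mFlagN d.factorial n (newtonSet (shift d (fun j => subst (PurePowerFlag.shift φ) (A j)) g)) = m := by
        rcases le_or_gt (n * d.factorial) (wOrdN n (newtonSet (shift d (fun j => subst (PurePowerFlag.shift φ) (A j)) g))) with h | h
        · rw [mFlagN_of_le h, ← hwOrd]
        · exact absurd (by rw [mFlagN_of_lt h]; exact Dvd.intro_left _ rfl) hdiv
      have hstrict : wMin w A < (d.factorial : ℕ∞) * g.weightedOrder w := by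
        refine lt_of_le_of_ne hG fun heq => hdiv ?_
        rw [hmF]
        have hgfin : g.weightedOrder w ≠ ⊤ := by
          intro h; rw [h, ENat.mul_top hfne, hm] at heq; exact ENat.coe_ne_top m heq
        refine ⟨(g.weightedOrder w).toNat, ?_⟩
        have : (m : ℕ∞) = ((d.factorial * (g.weightedOrder w).toNat : ℕ) : ℕ∞) := by
          rw [← hm, heq, Nat.cast_mul, ENat.coe_toNat hgfin]
        exact_mod_cast this
      have hle := h3 hstrict
      rw [h0, Nat.le_zero] at hle
      exact dFlagN_of_eq_zero hL0 hle
  · rw [not_le] at hG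
    have hmS : wMin w (shift d (fun j => subst (PurePowerFlag.shift φ) (A j)) g) = (d.factorial : ℕ∞) * g.weightedOrder w :=
      wMin_shift_eq_of_gt w _ g hd (by rw [hmB, ← hm]; exact hG)
    have hgfin : g.weightedOrder w ≠ ⊤ := by
      intro h; rw [h, ENat.mul_top hfne] at hG; exact not_top_lt hG
    have hmS' : wMin w (shift d (fun j => subst (PurePowerFlag.shift φ) (A j)) g) =
        ((d.factorial * (g.weightedOrder w).toNat : ℕ) : ℕ∞) := by rw [hmS, Nat.cast_mul, ENat.coe_toNat hgfin]
    have hNne : (newtonSet (shift d (fun j => subst (PurePowerFlag.shift φ) (A j)) g)).Nonempty := by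
      obtain ⟨P, hP⟩ := initPts_newtonSet_nonempty w _ hmS'
      exact ⟨P, hP.1⟩
    have hwN : wOrdN n (newtonSet (shift d (fun j => subst (PurePowerFlag.shift φ) (A j)) g)) = d.factorial * (g.weightedOrder w).toNat :=
      wOrdN_newtonSet_eq_of_wMin_eq hw0 hw1 _ hmS'
    have hwB : wOrdN n (newtonSet (fun j => subst (PurePowerFlag.shift φ) (A j))) = m := wOrdN_newtonSet_eq_of_wMin_eq hw0 hw1 _ hmB
    have hlt : d.factorial * (g.weightedOrder w).toNat < m := by
      have : ((d.factorial * (g.weightedOrder w).toNat : ℕ) : ℕ∞) < (m : ℕ∞) := by rw [← hmS', hmS, ← hm]; exact hG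
      exact_mod_cast this
    have hfloor : wOrdN n (newtonSet (shift d (fun j => subst (PurePowerFlag.shift φ) (A j)) g)) < n * d.factorial := by
      by_contra hge
      rw [not_lt] at hge
      have h1 : mFlagN d.factorial n (newtonSet (shift d (fun j => subst (PurePowerFlag.shift φ) (A j)) g)) =
          d.factorial * (g.weightedOrder w).toNat := by rw [mFlagN_of_le hge, hwN]
      have h2 : m ≤ mFlagN d.factorial n (newtonSet (fun j => subst (PurePowerFlag.shift φ) (A j))) := by
        rcases le_or_gt (n * d.factorial) (wOrdN n (newtonSet (fun j => subst (PurePowerFlag.shift φ) (A j)))) with h | h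
        · rw [mFlagN_of_le h, hwB]
        · rw [hwB] at h; rw [hwN] at hge; omega
      rw [h1] at hval; omega
    exact dFlagN_eq_zero_of_wOrdN_lt hNne hfloor

end WildMonic

end Summit.ResolutionOfSingularities.ResolutionOfSingularities.Theorems

end
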